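import Mathlib
import Summits.BirchSwinnertonDyer.BirchSwinnertonDyer.Theorems.OneSidedTwistSqueezeX9KatoDivisibilityX9ULedgerDefs

set_option autoImplicit false

-- the summit and its single problem are both named `BirchSwinnertonDyer` (registry layout D-0017)
set_option linter.dupNamespace false

/-!
# Entrywise congruences of `2 × 2` matrices modulo powers of an ideal
# (helpers for crux stmt-BirchSwinnertonDyer-20547 `KatoDivisibilityX9`, line `prime_adapted_tau`, stub 3 (U))

Mathlib-only lemmas about the predicate `EntryMem J A` («all entries of `A` lie in `J`», `…ULedgerDefs.lean`),
ported verbatim from §J1 of the bsd-f3-mu cell's kernel-checked sketch `Sketch71.lean` v5 f376123484d02b28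
(planner-bsd-f3-mu-desc g71; standalone check `d71/J71a.lean` 4d4b53f927e74da5; port plan PORT-PLAN-72 file P2,
desc g72).  They drive the `𝔪`-adic induction «`ρ_D(I_𝔓)` is pro-cyclic through a tame generator modulo every `𝔪^j`»
of `…ULedgerTameMonodromy.lean`:

* the `EntryMem` API (`zero/add/neg/sub/mono/smul/mul/mul_left/mul_right/trans/symm/iff_map_eq`);
* `entryMem_pow_sub_one`, `entryMem_pow_prime_sub_one`, `entryMem_pow_prime_pow_sub_one` — `A ≡ 1 (𝔪^j)`, `p ∈ 𝔪`
  ⟹ `A^{p^k} ≡ 1 (𝔪^{j+k})`;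
* `entryMem_commutator_of_congr_pow` — commutators of elements congruent to powers of one `T ≡ 1 (𝔪)` die one
  level deeper; `one_add_pow_of_sq_zero` — `(1 + ν)^k = 1 + k ν` for `ν² = 0`;
* `exists_smul_eq_of_forall_congr` — KRULL: over a Noetherian local domain, a matrix congruent to multiples of a
  fixed non-zero `ν` modulo every `𝔪^j` IS a multiple of `ν`.

(`continuous_of_isOpen_fibers` of the same § is in `…ULedgerTameKummer.lean`.)  Folklore; no ledger item is closed here.
-/

open scoped Classical
open Matrix Finset

noncomputable section

namespace Summit.BirchSwinnertonDyer.BirchSwinnertonDyer.Theorems.OneSidedTwistSqueezeX9KatoDivisibilityX9ULedger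

section JKernels

variable {R : Type*} [CommRing R]

namespace EntryMem

variable {J J₁ J₂ : Ideal R} {A B : Matrix (Fin 2) (Fin 2) R}

/-- The zero matrix has entries in `J`. -/
theorem zero : EntryMem J (0 : Matrix (Fin 2) (Fin 2) R) := fun _ _ => J.zero_mem

/-- `EntryMem J` is closed under addition. -/
theorem add (hA : EntryMem J A) (hB : EntryMem J B) : EntryMem J (A + B) := fun a b => by
  rw [Matrix.add_apply]; exact J.add_mem (hA a b) (hB a b)

/-- `EntryMem J` is closed under negation. -/
theorem neg (hA : EntryMem J A) : EntryMem J (-A) := fun a b => by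
  rw [Matrix.neg_apply]; exact J.neg_mem (hA a b)

/-- `EntryMem J` is closed under subtraction. -/
theorem sub (hA : EntryMem J A) (hB : EntryMem J B) : EntryMem J (A - B) := fun a b => by
  rw [Matrix.sub_apply]; exact J.sub_mem (hA a b) (hB a b)

/-- `EntryMem` is monotone in the ideal. -/
theorem mono (h : J₁ ≤ J₂) (hA : EntryMem J₁ A) : EntryMem J₂ A := fun a b => h (hA a b)

/-- `EntryMem J` is closed under scalars. -/
theorem smul (c : R) (hA : EntryMem J A) : EntryMem J (c • A) := fun a b => by
  rw [Matrix.smul_apply, smul_eq_mul]; exact J.mul_mem_left c (hA a b)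

/-- `M₂(J₁) · M₂(J₂) ⊆ M₂(J₁ J₂)`. [folklore] -/
theorem mul (hA : EntryMem J₁ A) (hB : EntryMem J₂ B) : EntryMem (J₁ * J₂) (A * B) := fun a b => by
  rw [Matrix.mul_apply]
  exact Ideal.sum_mem _ fun c _ => Ideal.mul_mem_mul (hA a c) (hB c b)

/-- `M₂(R) · M₂(J) ⊆ M₂(J)`. -/
theorem mul_left (S : Matrix (Fin 2) (Fin 2) R) (hB : EntryMem J B) : EntryMem J (S * B) := fun a b => by
  rw [Matrix.mul_apply]
  exact Ideal.sum_mem _ fun c _ => J.mul_mem_left _ (hB c b)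

/-- `M₂(J) · M₂(R) ⊆ M₂(J)`. -/
theorem mul_right (S : Matrix (Fin 2) (Fin 2) R) (hA : EntryMem J A) : EntryMem J (A * S) := fun a b => by
  rw [Matrix.mul_apply]
  exact Ideal.sum_mem _ fun c _ => J.mul_mem_right _ (hA a c)

/-- Congruence is transitive: `A ≡ B`, `B ≡ C` ⟹ `A ≡ C`. [folklore] -/
theorem trans {C : Matrix (Fin 2) (Fin 2) R} (h₁ : EntryMem J (A - B)) (h₂ : EntryMem J (B - C)) :
    EntryMem J (A - C) := by
  have := h₁.add h₂; rwa [sub_add_sub_cancel] at this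

/-- Congruence is symmetric. -/
theorem symm (h : EntryMem J (A - B)) : EntryMem J (B - A) := by
  have := h.neg; rwa [neg_sub] at this

/-- `EntryMem J (A - B)` iff the reductions mod `J` agree. [folklore] -/
theorem iff_map_eq : EntryMem J (A - B) ↔ A.map (Ideal.Quotient.mk J) = B.map (Ideal.Quotient.mk J) := by
  rw [← Matrix.ext_iff]
  refine forall₂_congr fun a b => ?_
  rw [Matrix.map_apply, Matrix.map_apply, Ideal.Quotient.eq, Matrix.sub_apply]

end EntryMem

/-- `A ≡ 1 (mod J)` ⟹ `A^k ≡ 1 (mod J)`. [folklore] -/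
theorem entryMem_pow_sub_one {J : Ideal R} {A : Matrix (Fin 2) (Fin 2) R} (hA : EntryMem J (A - 1)) (k : ℕ) :
    EntryMem J (A ^ k - 1) := by
  induction k with
  | zero => rw [pow_zero, sub_self]; exact EntryMem.zero
  | succ k ih =>
    have e : A ^ (k + 1) - 1 = A ^ k * (A - 1) + (A ^ k - 1) := by rw [pow_succ]; noncomm_ring
    rw [e]; exact (hA.mul_left _).add ih

/-- **`p`-power lemma**: `(p : R) ∈ 𝔪`, `A ≡ 1 (mod 𝔪)` and `A ≡ 1 (mod 𝔪^i)` ⟹ `A^p ≡ 1 (mod 𝔪^(i+1))`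
(`A^p − 1 = (1 + A + ⋯ + A^{p−1})(A − 1)` and the first factor is `≡ p ≡ 0 (mod 𝔪)`). [folklore] -/
theorem entryMem_pow_prime_sub_one {𝔪 : Ideal R} {p : ℕ} (hp : (p : R) ∈ 𝔪) {A : Matrix (Fin 2) (Fin 2) R}
    (h1 : EntryMem 𝔪 (A - 1)) {i : ℕ} (hi : EntryMem (𝔪 ^ i) (A - 1)) :
    EntryMem (𝔪 ^ (i + 1)) (A ^ p - 1) := by
  have hS : EntryMem 𝔪 (∑ k ∈ range p, A ^ k) := by
    have hdiff : EntryMem 𝔪 (∑ k ∈ range p, A ^ k - (p : R) • (1 : Matrix (Fin 2) (Fin 2) R)) := by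
      have e : ∑ k ∈ range p, A ^ k - (p : R) • (1 : Matrix (Fin 2) (Fin 2) R) = ∑ k ∈ range p, (A ^ k - 1) := by
        rw [Finset.sum_sub_distrib, Finset.sum_const, Finset.card_range, ← Nat.cast_smul_eq_nsmul R]
      rw [e]
      intro a b
      rw [Matrix.sum_apply]
      exact Ideal.sum_mem _ fun k _ => entryMem_pow_sub_one h1 k a b
    have hp1 : EntryMem 𝔪 ((p : R) • (1 : Matrix (Fin 2) (Fin 2) R)) := by
      intro a b
      rw [Matrix.smul_apply, smul_eq_mul]
      exact 𝔪.mul_mem_right _ hp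
    have := hdiff.add hp1
    rwa [sub_add_cancel] at this
  have e : A ^ p - 1 = (∑ k ∈ range p, A ^ k) * (A - 1) := (geom_sum_mul A p).symm
  rw [e, pow_succ']
  exact hS.mul hi

/-- Iterated: `A ≡ 1 (mod 𝔪)` ⟹ `A^(p^j) ≡ 1 (mod 𝔪^(j+1))`. [folklore] -/
theorem entryMem_pow_prime_pow_sub_one {𝔪 : Ideal R} {p : ℕ} (hp : (p : R) ∈ 𝔪) {A : Matrix (Fin 2) (Fin 2) R}
    (h1 : EntryMem 𝔪 (A - 1)) (j : ℕ) : EntryMem (𝔪 ^ (j + 1)) (A ^ (p ^ j) - 1) := by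
  induction j with
  | zero => simpa only [pow_zero, pow_one, zero_add] using h1
  | succ j ih =>
    rw [show p ^ (j + 1) = p ^ j * p from pow_succ p j, pow_mul]
    exact entryMem_pow_prime_sub_one hp (entryMem_pow_sub_one h1 _) ih

/-- **Commutativity one level up.** If `T ≡ 1 (mod 𝔪)`, `X ≡ T^a`, `Y ≡ T^b (mod 𝔪^j)` with `1 ≤ j`, then
`XY ≡ YX (mod 𝔪^(j+1))`. [folklore] -/
theorem entryMem_commutator_of_congr_pow {𝔪 : Ideal R} {T X Y : Matrix (Fin 2) (Fin 2) R} (hT : EntryMem 𝔪 (T - 1))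
    {j : ℕ} (hj : 1 ≤ j) {a b : ℕ} (hX : EntryMem (𝔪 ^ j) (X - T ^ a)) (hY : EntryMem (𝔪 ^ j) (Y - T ^ b)) :
    EntryMem (𝔪 ^ (j + 1)) (X * Y - Y * X) := by
  set U := X - T ^ a with hU
  set V := Y - T ^ b with hV
  have hPQ : T ^ a * T ^ b = T ^ b * T ^ a := by rw [← pow_add, ← pow_add, add_comm]
  have e : X * Y - Y * X =
      ((T ^ a - 1) * V - V * (T ^ a - 1)) + (U * (T ^ b - 1) - (T ^ b - 1) * U) + (U * V - V * U) := by
    have hX' : X = T ^ a + U := by rw [hU, add_sub_cancel]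
    have hY' : Y = T ^ b + V := by rw [hV, add_sub_cancel]
    rw [hX', hY']
    have : (T ^ a + U) * (T ^ b + V) - (T ^ b + V) * (T ^ a + U) =
        ((T ^ a - 1) * V - V * (T ^ a - 1)) + (U * (T ^ b - 1) - (T ^ b - 1) * U) + (U * V - V * U) +
          (T ^ a * T ^ b - T ^ b * T ^ a) := by noncomm_ring
    rw [this, hPQ, sub_self, add_zero]
  rw [e]
  have hle : 𝔪 ^ j * 𝔪 ^ j ≤ 𝔪 ^ (j + 1) := by
    rw [← pow_add]; exact Ideal.pow_le_pow_right (by omega)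
  refine EntryMem.add (EntryMem.add ?_ ?_) ?_
  · rw [pow_succ']
    refine ((entryMem_pow_sub_one hT a).mul hY).sub ?_
    rw [mul_comm (𝔪 : Ideal R)]
    exact hY.mul (entryMem_pow_sub_one hT a)
  · rw [pow_succ]
    refine (hX.mul (entryMem_pow_sub_one hT b)).sub ?_
    rw [mul_comm (𝔪 ^ j : Ideal R)]
    exact (entryMem_pow_sub_one hT b).mul hX
  · exact ((hX.mul hY).sub (hY.mul hX)).mono hle

/-- `(1 + ν)^k = 1 + k ν` for `ν² = 0`. [folklore] -/
theorem one_add_pow_of_sq_zero (ν : Matrix (Fin 2) (Fin 2) R) (hν : ν * ν = 0) (k : ℕ) :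
    (1 + ν) ^ k = 1 + (k : R) • ν := by
  induction k with
  | zero => simp
  | succ k ih =>
    rw [pow_succ, ih, add_mul, mul_add, mul_add, one_mul, mul_one, one_mul, Matrix.smul_mul, hν, smul_zero, add_zero,
      Nat.cast_succ, add_smul, one_smul]
    abel

/-- **Scalar parameter from congruences (Krull).**  Over a Noetherian local domain: if for every `j` some scalar
`k` has `M ≡ k ν (mod 𝔪^j)`, then `M = s ν` for one `s ∈ R`. [folklore] -/
theorem exists_smul_eq_of_forall_congr [IsDomain R] [IsNoetherianRing R] [IsLocalRing R]
    (M ν : Matrix (Fin 2) (Fin 2) R)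
    (h : ∀ j : ℕ, ∃ k : R, EntryMem (IsLocalRing.maximalIdeal R ^ j) (M - k • ν)) : ∃ s : R, M = s • ν := by
  set 𝔪 := IsLocalRing.maximalIdeal R with h𝔪
  have h𝔪top : 𝔪 ≠ ⊤ := (IsLocalRing.maximalIdeal.isMaximal R).ne_top
  -- Krull
  have hK : ∀ x : R, (∀ j : ℕ, x ∈ 𝔪 ^ j) → x = 0 := by
    intro x hx
    have : x ∈ (⨅ j : ℕ, 𝔪 ^ j : Ideal R) := Ideal.mem_iInf.mpr hx
    rwa [Ideal.iInf_pow_eq_bot_of_isLocalRing 𝔪 h𝔪top, Ideal.mem_bot] at this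
  -- cross relations
  have hcross : ∀ a b c d, M a b * ν c d = M c d * ν a b := by
    intro a b c d
    rw [← sub_eq_zero]
    refine hK _ fun j => ?_
    obtain ⟨k, hk⟩ := h j
    have e : M a b * ν c d - M c d * ν a b = (M - k • ν) a b * ν c d - (M - k • ν) c d * ν a b := by
      simp only [Matrix.sub_apply, Matrix.smul_apply, smul_eq_mul]; ring
    rw [e]
    exact Ideal.sub_mem _ (Ideal.mul_mem_right _ _ (hk a b)) (Ideal.mul_mem_right _ _ (hk c d))
  -- each entry of `M` is a multiple of the corresponding entry of `ν`
  have hentry : ∀ a b, ∃ s : R, s * ν a b = M a b := by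
    intro a b
    rw [← Ideal.mem_span_singleton', ← Ideal.Quotient.eq_zero_iff_mem]
    set J : Ideal R := Ideal.span {ν a b}
    have hmem : (Ideal.Quotient.mk J (M a b) : R ⧸ J) ∈ (⨅ i : ℕ, 𝔪 ^ i • ⊤ : Submodule R (R ⧸ J)) := by
      refine Submodule.mem_iInf _ |>.mpr fun i => ?_
      obtain ⟨k, hk⟩ := h i
      have e : Ideal.Quotient.mk J (M a b) = Ideal.Quotient.mk J ((M - k • ν) a b) := by
        rw [Ideal.Quotient.eq, Matrix.sub_apply, Matrix.smul_apply, smul_eq_mul, sub_sub_cancel]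
        exact Ideal.mem_span_singleton'.mpr ⟨k, rfl⟩
      rw [e]
      have e2 : (Ideal.Quotient.mk J ((M - k • ν) a b) : R ⧸ J) = (M - k • ν) a b • (1 : R ⧸ J) := by
        rw [← Algebra.algebraMap_eq_smul_one, Ideal.Quotient.algebraMap_eq]
      rw [e2]
      exact Submodule.smul_mem_smul (hk a b) Submodule.mem_top
    rwa [Ideal.iInf_pow_smul_eq_bot_of_isLocalRing (M := R ⧸ J) 𝔪 h𝔪top, Submodule.mem_bot] at hmem
  by_cases hν : ν = 0
  · refine ⟨0, ?_⟩
    rw [zero_smul]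
    ext a b
    refine hK _ fun j => ?_
    obtain ⟨k, hk⟩ := h j
    have := hk a b
    rwa [hν, smul_zero, sub_zero] at this
  · obtain ⟨a, b, hab⟩ : ∃ a b, ν a b ≠ 0 := by
      by_contra hcon
      push Not at hcon
      exact hν (Matrix.ext fun a b => by rw [hcon a b, Matrix.zero_apply])
    obtain ⟨s, hs⟩ := hentry a b
    refine ⟨s, Matrix.ext fun c d => ?_⟩
    rw [Matrix.smul_apply, smul_eq_mul]
    have h1 := hcross c d a b
    rw [← hs] at h1
    -- `M c d * ν a b = s * ν a b * ν c d`
    have h2 : (M c d - s * ν c d) * ν a b = 0 := by rw [sub_mul, h1]; ring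
    rcases mul_eq_zero.mp h2 with h3 | h3
    · exact sub_eq_zero.mp h3
    · exact (hab h3).elim

end JKernels

end Summit.BirchSwinnertonDyer.BirchSwinnertonDyer.Theorems.OneSidedTwistSqueezeX9KatoDivisibilityX9ULedger
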